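import Mathlib.Data.Real.Basic
import Mathlib.Algebra.Order.Field.Basic
import Mathlib.Tactic.Linarith
import Mathlib.Tactic.Positivity
import Mathlib.Tactic.Ring
import Mathlib.Tactic.FieldSimp
import HarnessLib

/-!
# `NoHeavyLowerTail` (stmt-CriticalPhenomena-4575) — the (V-F) hypothesis-only step as a subadditivity defect, and "bad pieces have low interior ratio"

Support file (prover prim-ineq-gen-8 gen 48; `--supports stmt-CriticalPhenomena-4575`; memo
run/shared/lean/prim/prim-ineq-gen-8/FINDING-gen48-AMGM.md §7(d′),(d″)).  Pure real algebra: no definitions, no named facts, no sorries.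

SETTING (companions `…APLVwAMGMStep.lean`, `…APLVwAMGMWindow.lean`).  For a boundary edge `e` (weight `p`, `q = 1−p`) with piece moments
`a = E D`, `b = E D²`, `c = Σ_z ℓ_z φ_z²`, put `x := b − a²` (the piece's own variance) and `f := a − c = Σ_z ℓ_z φ_z(1 − φ_z)` (its own `F`).
The piece is BAD when `a³ > 2bc` (only then can the (V-F) step `V² ≤ F(p(V¹)²/F¹ + q(V⁰)²/F⁰ + 2pq ab)` fail at `e`, by `good_piece_quadratic` /
the subadditivity of `v²/f`: `persp_subadd` below).  THIS FILE [this work]: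
* `persp_subadd` — `(v₁+v₂)²/(f₁+f₂) ≤ v₁²/f₁ + v₂²/f₂` with the exact defect `(v₁f₂ − v₂f₁)²/(f₁f₂(f₁+f₂))` (`persp_defect`); iterating it gives
  `V²/F ≤ p(V¹)²/F¹ + q(V⁰)²/F⁰ + pq a⁴/c`, so the (V-F) step holds at `e` as soon as the alignment defect exceeds `pq·a(a³ − 2bc)/c` (memo §7(d′)).
* `bad_piece_interior` (LEMMA C) — if `a³ > 2bc` then `x·c < a²·f`, i.e. the interior variance/F ratio satisfies `x/f < b/a` (`bad_piece_ratio_lt`),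
  and `b/a` is below the window of `e` (`θ₋ ≥ b/a`); three lines: `(b − a²)c = bc − a²c < a³/2 − a²c ≤ a²(a − c)`.
* `bad_gadget_ratio_le` (LEMMA C′) — for a bad piece hung by an edge of weight `p`, the whole gadget's ratio `(q a² + x)/(q c + f) ≤ b/a`
  (slack `p(a²f − xc)`), whence on a forest the rest of the largest-ratio edge and both of its children have `V/F ≤ b/a ≤ θ₋` (memo §7(d″)).
-/

noncomputable section

namespace Summit.CriticalPhenomena.PercolationContinuityZ3.Theorems

namespace APL

/-- **Defect identity for the perspective `v²/f`.**  For `f₁, f₂ > 0`: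
`v₁²/f₁ + v₂²/f₂ − (v₁+v₂)²/(f₁+f₂) = (v₁f₂ − v₂f₁)²/(f₁f₂(f₁+f₂))`. [standard; recorded] -/
theorem persp_defect (v1 v2 f1 f2 : ℝ) (h1 : 0 < f1) (h2 : 0 < f2) :
    v1 ^ 2 / f1 + v2 ^ 2 / f2 - (v1 + v2) ^ 2 / (f1 + f2) = (v1 * f2 - v2 * f1) ^ 2 / (f1 * f2 * (f1 + f2)) := by
  have h12 : 0 < f1 + f2 := by linarith
  field_simp
  ring

/-- **Subadditivity of the perspective `v²/f`** (convex and 1-homogeneous): `(v₁+v₂)²/(f₁+f₂) ≤ v₁²/f₁ + v₂²/f₂` for `f₁, f₂ > 0`. [standard; recorded] -/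
theorem persp_subadd (v1 v2 f1 f2 : ℝ) (h1 : 0 < f1) (h2 : 0 < f2) :
    (v1 + v2) ^ 2 / (f1 + f2) ≤ v1 ^ 2 / f1 + v2 ^ 2 / f2 := by
  have hd := persp_defect v1 v2 f1 f2 h1 h2
  have hnn : 0 ≤ (v1 * f2 - v2 * f1) ^ 2 / (f1 * f2 * (f1 + f2)) := by positivity
  linarith

/-- **Three-term subadditivity in the shape of the (V-F) step.**  With `V = pq a² + pV¹ + qV⁰`, `F = pq c + pF¹ + qF⁰`, all `F`'s and `c` positive and
`p ∈ (0,1)`:  `V²/F ≤ p (V¹)²/F¹ + q (V⁰)²/F⁰ + p q a⁴/c`.  Hence the (V-F) step `V² ≤ F(p(V¹)²/F¹ + q(V⁰)²/F⁰ + 2pq ab)` holds whenever `a⁴/c ≤ 2ab`,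
i.e. for every good piece, and in general it is equivalent to "alignment defect ≥ `pq(a⁴/c − 2ab)`". [this work] -/
theorem vf_three_term (p a c V1 V0 F1 F0 : ℝ) (hp0 : 0 < p) (hp1 : p < 1) (hc : 0 < c) (hF1 : 0 < F1) (hF0 : 0 < F0) :
    (p * (1 - p) * a ^ 2 + p * V1 + (1 - p) * V0) ^ 2 / (p * (1 - p) * c + p * F1 + (1 - p) * F0)
      ≤ p * (V1 ^ 2 / F1) + (1 - p) * (V0 ^ 2 / F0) + p * (1 - p) * (a ^ 4 / c) := by
  have hq : 0 < 1 - p := by linarith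
  have hpq : 0 < p * (1 - p) := mul_pos hp0 hq
  -- apply two-term subadditivity twice, with the scaled vectors (pV1, pF1), (qV0, qF0), (pq a², pq c)
  have s1 := persp_subadd (p * V1) ((1 - p) * V0) (p * F1) ((1 - p) * F0) (by positivity) (by positivity)
  have s2 := persp_subadd (p * V1 + (1 - p) * V0) (p * (1 - p) * a ^ 2) (p * F1 + (1 - p) * F0) (p * (1 - p) * c)
    (by positivity) (by positivity)
  have e1 : (p * V1) ^ 2 / (p * F1) = p * (V1 ^ 2 / F1) := by field_simp
  have e0 : ((1 - p) * V0) ^ 2 / ((1 - p) * F0) = (1 - p) * (V0 ^ 2 / F0) := by field_simp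
  have e2 : (p * (1 - p) * a ^ 2) ^ 2 / (p * (1 - p) * c) = p * (1 - p) * (a ^ 4 / c) := by field_simp
  have hperm : (p * (1 - p) * a ^ 2 + p * V1 + (1 - p) * V0) ^ 2 / (p * (1 - p) * c + p * F1 + (1 - p) * F0)
      = (p * V1 + (1 - p) * V0 + p * (1 - p) * a ^ 2) ^ 2 / (p * F1 + (1 - p) * F0 + p * (1 - p) * c) := by ring_nf
  rw [hperm]
  calc (p * V1 + (1 - p) * V0 + p * (1 - p) * a ^ 2) ^ 2 / (p * F1 + (1 - p) * F0 + p * (1 - p) * c)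
      ≤ (p * V1 + (1 - p) * V0) ^ 2 / (p * F1 + (1 - p) * F0) + (p * (1 - p) * a ^ 2) ^ 2 / (p * (1 - p) * c) := s2
    _ ≤ (p * V1) ^ 2 / (p * F1) + ((1 - p) * V0) ^ 2 / ((1 - p) * F0) + (p * (1 - p) * a ^ 2) ^ 2 / (p * (1 - p) * c) := by linarith [s1]
    _ = p * (V1 ^ 2 / F1) + (1 - p) * (V0 ^ 2 / F0) + p * (1 - p) * (a ^ 4 / c) := by rw [e1, e0, e2]

/-- **LEMMA C: a bad piece has low interior variance-to-F ratio.**  If `a > 0`, `c ≥ 0`, `b = a² + x`, `f = a − c` and the piece is bad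
(`2bc < a³`), then `x·c < a²·f`. [this work] -/
theorem bad_piece_interior (a b c x f : ℝ) (ha : 0 < a) (hc : 0 ≤ c) (hb : b = a ^ 2 + x) (hf : f = a - c)
    (hbad : 2 * b * c < a ^ 3) : x * c < a ^ 2 * f := by
  subst hb hf
  have h0 : 0 ≤ a ^ 2 * c := mul_nonneg (sq_nonneg a) hc
  nlinarith [h0, ha]

/-- Corollary of Lemma C in ratio form: for a bad piece with `f > 0`, `x/f < b/a` (and `b/a ≤ θ₋`, the lower end of the window of `e`). [this work] -/
theorem bad_piece_ratio_lt (a b c x f : ℝ) (ha : 0 < a) (hc : 0 ≤ c) (hfpos : 0 < f) (hb : b = a ^ 2 + x) (hf : f = a - c)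
    (hbad : 2 * b * c < a ^ 3) : x / f < b / a := by
  have key := bad_piece_interior a b c x f ha hc hb hf hbad
  rw [div_lt_div_iff₀ hfpos ha]
  -- x * a < b * f  ⟸  x a = ... ; use b f = (a² + x)(a − c) = a² f + x f and x c < a² f with f = a − c
  subst hb hf
  nlinarith [key, ha, hfpos]

/-- **LEMMA C′: the whole gadget of a bad piece has ratio at most `b/a`.**  With `q ≤ 1`: `a·(q a² + x) ≤ b·(q c + f)` (the gadget hung by an edge of
weight `p = 1 − q` has `V_g/F_g = (q a² + x)/(q c + f)`); the slack is `p·(a²f − xc) ≥ 0`. [this work] -/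
theorem bad_gadget_ratio_le (q a b c x f : ℝ) (hq1 : q ≤ 1) (ha : 0 < a) (hc : 0 ≤ c) (hb : b = a ^ 2 + x) (hf : f = a - c)
    (hbad : 2 * b * c < a ^ 3) : a * (q * a ^ 2 + x) ≤ b * (q * c + f) := by
  have key := bad_piece_interior a b c x f ha hc hb hf hbad
  subst hb hf
  -- b (q c + f) − a (q a² + x) = (1 − q)(a² f − x c) with f = a − c
  have hid : (a ^ 2 + x) * (q * c + (a - c)) - a * (q * a ^ 2 + x) = (1 - q) * (a ^ 2 * (a - c) - x * c) := by ring
  nlinarith [hid, mul_nonneg (by linarith : (0:ℝ) ≤ 1 - q) (by linarith [key] : (0:ℝ) ≤ a ^ 2 * (a - c) - x * c)]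

end APL

end Summit.CriticalPhenomena.PercolationContinuityZ3.Theorems
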